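import Literature.NumberTheory.Automorphic.HyperspecialUnitarySatakeImage
import Literature.NumberTheory.Automorphic.HyperspecialUnitarySatakeInjective
import HarnessLib

/-!
# The Satake isomorphism `ℋ(U(σ, J₀), K₀) ≅ ℂ[Λ⁻]^W` for the quasi-split unitary group in every rank
# (Cartier 1979 §IV Thm. 4.1; Satake 1963 Thm. 7 §6; Mínguez 2011 §4)

Topic `NumberTheory/Automorphic`; namespace `Literature.NumberTheory.Automorphic.HermitianLattice[.UnramifiedLocalConjDatum]`
(lane `lit-hodgefound`, Track 2 foundations; seat `lit-hodgefound-p11`, generation 48, row g48-#7).  DEFINITIONS with bodies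
(`headSum`, `headSumVec`, `swapPairs`, `flipPair`, `lowerDominantSet`, `satakeAlgEquiv`) + theorems; no named fact, no instance, no notation.

## The mathematics

`G = U_N = U(σ, J₀^{(N)})` over a `ℤᵐ⁰`-valued field with unramified conjugation datum (`σ ≠ id`, finite residue field,
`q = q_F²`), `K₀ = G ∩ GL_N(𝒪)` hyperspecial, `𝒮 : ℋ(G, K₀) → ℂ[ℤ^N]` the Satake transform (`HyperspecialUnitarySatakeTransform`),
`Λ⁻ = {μ : μ ∘ rev = -μ}`, `W = C_{S_N}(rev)`, `ℂ[Λ⁻]^W = unitarySatakeTarget ℂ N` (`HyperspecialUnitarySatakeImage`).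
THEOREM (Satake isomorphism, [CartierCorvallis1979] §IV Thm. 4.1): **`𝒮` is an algebra isomorphism of `ℋ(G, K₀)` onto
`ℂ[Λ⁻]^W`.**  Injectivity is `HyperspecialUnitarySatakeInjective.satakeTransform_injective`, `range 𝒮 ⊆ ℂ[Λ⁻]^W` is
`HyperspecialUnitarySatakeImage` (Weyl invariance by Levi descent, `HyperspecialUnitarySatakeWeylInvariance`); this file proves the
SURJECTIVITY onto `ℂ[Λ⁻]^W` by Cartier's triangular induction (proof of Thm. 4.1 (c)): for `f ∈ ℂ[Λ⁻]^W`, `f ≠ 0`, an exponent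
`a ∈ supp f` with lexicographically maximal head sums is DOMINANT (`a_0 ≥ a_1 ≥ … `; §2: otherwise a double transposition
`(j j')(rev j, rev j')` or a flip `(n-1, rev(n-1))` in `W` raises the head sums inside the `W`-stable set `supp f`), the basic
operator `T_a = 𝟙_{K₀ ϖ^a K₀}` has `𝒮(T_a) = c_a x^a + (terms x^μ, μ <_d a)` with `c_a ≠ 0` (`HyperspecialUnitarySatakeInjective`
§3, from [BruhatTits1972] (4.4.4)), and `f - (f_a / c_a) 𝒮(T_a) ∈ ℂ[Λ⁻]^W` has a strictly smaller finite set
`U(f) = {λ dominant : λ ≤_d b for some dominant b ∈ supp f}`; induction on `#U(f)`.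

## What is formalised

* §1 `headSum`, `headSumVec`, `headSum_succ`, `headSum_comp_eq_of_forall_lt`, `eq_of_headSum_le_antisymm` (dominance is
  antisymmetric), `eq_of_headSum_le_of_toLex_le`.
* §2 `swapPairs`, `flipPair` (elements of `W`: value tables, `rev`-commutation), **`antitone_of_isMaxOn_headSumVec`** (a head-sum
  lex-maximal element of a `W`-stable finite set of antisymmetric exponents is dominant).
* §3 `finite_setOf_antitone_headSum_le` (finitely many dominant antisymmetric `λ ≤_d a`).
* §4 `lowerDominantSet U(f)`, `finite_lowerDominantSet`, **`exists_satakeTransform_eq`** (SURJECTIVITY onto `ℂ[Λ⁻]^W`), **`range_satakeTransform_eq_unitarySatakeTarget`**,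
  **`satakeAlgEquiv : ℋ(U(σ, J₀^{(N)}), K₀) ≃ₐ[ℂ] ℂ[Λ⁻]^W`** (THE SATAKE ISOMORPHISM), `coe_satakeAlgEquiv`.

## References
* [CartierCorvallis1979] P. Cartier, *Representations of 𝔭-adic groups: a survey*, PSPM 33.1 (1979), §IV Thm. 4.1 and its proof.
* [Satake1963] I. Satake, *Theory of spherical functions on reductive algebraic groups over 𝔭-adic fields*, Publ. Math. IHÉS 18
  (1963), §6 Thm. 7, §8.
* [BruhatTits1972] F. Bruhat, J. Tits, *Groupes réductifs sur un corps local I*, Publ. Math. IHÉS 41 (1972), (4.4.3), (4.4.4).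
* [Minguez2011] A. Mínguez, *Unramified representations of unitary groups*, in: *On the stabilization of the trace formula* (2011), §4.
* [Macdonald1971] I. G. Macdonald, *Spherical functions on a group of p-adic type*, Madras (1971), Ch. IV–V.
-/

noncomputable section

open scoped Valued WithZero Matrix MatrixGroups
open MonoidAlgebra Representation

namespace Literature.NumberTheory.Automorphic.HermitianLattice

open Literature.NumberTheory.Automorphic Literature.NumberTheory.Automorphic.CartanUnique
  Literature.NumberTheory.Automorphic.SymplecticCartan

variable {N : ℕ}

/-! ## §1 Head sums and the dominance order -/

section HeadSums

/-- The head sum `Σ_{i<r} μ_i`. [cite: BruhatTits1972, (4.4.4)] -/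
def headSum (μ : Fin N → ℤ) (r : ℕ) : ℤ := ∑ i : Fin N, if (i : ℕ) < r then μ i else 0

/-- Unfolding `headSum`. [cite: BruhatTits1972, (4.4.4)] -/
theorem headSum_eq (μ : Fin N → ℤ) (r : ℕ) : headSum μ r = ∑ i : Fin N, if (i : ℕ) < r then μ i else 0 := rfl

/-- The vector of head sums `(Σ_{i≤r} μ_i)_r`, compared lexicographically. [cite: BruhatTits1972, (4.4.4)] -/
def headSumVec (μ : Fin N → ℤ) : Fin N → ℤ := fun r => headSum μ ((r : ℕ) + 1)

/-- Unfolding `headSumVec`. [cite: BruhatTits1972, (4.4.4)] -/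
theorem headSumVec_apply (μ : Fin N → ℤ) (r : Fin N) : headSumVec μ r = headSum μ ((r : ℕ) + 1) := rfl

/-- `Σ_{i<0} μ_i = 0`. [cite: BruhatTits1972, (4.4.4)] -/
@[simp] theorem headSum_zero (μ : Fin N → ℤ) : headSum μ 0 = 0 := by
  simp [headSum]

/-- `Σ_{i<j+1} μ_i = Σ_{i<j} μ_i + μ_j`. [cite: BruhatTits1972, (4.4.4)] -/
theorem headSum_succ (μ : Fin N → ℤ) (j : Fin N) : headSum μ ((j : ℕ) + 1) = headSum μ j + μ j := by
  rw [headSum, headSum, ← sub_eq_iff_eq_add', ← Finset.sum_sub_distrib,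
    Finset.sum_eq_single_of_mem j (Finset.mem_univ _) fun i _ hi => ?_]
  · rw [if_pos (Nat.lt_succ_self _), if_neg (lt_irrefl _), sub_zero]
  · have hij : (i : ℕ) ≠ (j : ℕ) := fun h => hi (Fin.ext h)
    by_cases h1 : (i : ℕ) < (j : ℕ)
    · rw [if_pos (by omega), if_pos h1, sub_self]
    · rw [if_neg (by omega), if_neg h1, sub_self]

/-- Head sums of `μ ∘ s` agree with those of `μ` below the first index moved by `s`. [cite: BruhatTits1972, (4.4.4)] -/
theorem headSum_comp_eq_of_forall_lt (μ : Fin N → ℤ) (s : Equiv.Perm (Fin N)) (r : ℕ) (h : ∀ i : Fin N, (i : ℕ) < r → s i = i) :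
    headSum (μ ∘ s) r = headSum μ r := by
  refine Finset.sum_congr rfl fun i _ => ?_
  split_ifs with hi
  · rw [Function.comp_apply, h i hi]
  · rfl

/-- **The dominance order is antisymmetric**: `μ ≤_d ν ≤_d μ ⇒ μ = ν`. [cite: BruhatTits1972, (4.4.4)] -/
theorem eq_of_headSum_le_antisymm {μ ν : Fin N → ℤ} (h : ∀ r, headSum μ r ≤ headSum ν r) (h' : ∀ r, headSum ν r ≤ headSum μ r) :
    μ = ν :=
  eq_of_forall_le_of_toLex_le h (toLex_headSum_le_of_forall_le h')

/-- `μ ≤_d ν` and `headSumVec ν ≤_lex headSumVec μ` imply `μ = ν`. [cite: BruhatTits1972, (4.4.4)] -/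
theorem eq_of_headSum_le_of_toLex_le {μ ν : Fin N → ℤ} (h : ∀ r, headSum μ r ≤ headSum ν r)
    (hle : toLex (headSumVec ν) ≤ toLex (headSumVec μ)) : μ = ν :=
  eq_of_forall_le_of_toLex_le h hle

/-- A strict head-sum increase at `r₀` with equality below makes `headSumVec` lexicographically bigger.
[cite: BruhatTits1972, (4.4.4)] -/
theorem toLex_headSumVec_lt {μ ν : Fin N → ℤ} (r₀ : Fin N) (heq : ∀ r : ℕ, r ≤ (r₀ : ℕ) → headSum μ r = headSum ν r)
    (hlt : headSum μ ((r₀ : ℕ) + 1) < headSum ν ((r₀ : ℕ) + 1)) : toLex (headSumVec μ) < toLex (headSumVec ν) :=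
  ⟨r₀, fun j hj => heq _ (by exact Nat.succ_le_of_lt hj), hlt⟩

end HeadSums

/-! ## §2 A head-sum maximal element of a `W`-stable set of antisymmetric exponents is dominant -/

section LexMax

/-- **`(j j')(rev j, rev j')`**, the double transposition exchanging the coordinate pairs of `j` and `j'`. [cite: BruhatTits1972, (4.4.3)] -/
def swapPairs (j j' : Fin N) : Equiv.Perm (Fin N) := Equiv.swap j j' * Equiv.swap (Fin.rev j) (Fin.rev j')

/-- The value table of `(j j')(rev j, rev j')` for `j, j' < ⌊N/2⌋`, `j ≠ j'`. [cite: BruhatTits1972, (4.4.3)] -/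
theorem swapPairs_val {j j' : Fin N} (hjj' : j ≠ j') (hj : (j : ℕ) < N / 2) (hj' : (j' : ℕ) < N / 2) (i : Fin N) :
    ((swapPairs j j' i : Fin N) : ℕ) =
      if (i : ℕ) = N - 1 - (j : ℕ) then N - 1 - (j' : ℕ) else if (i : ℕ) = N - 1 - (j' : ℕ) then N - 1 - (j : ℕ)
      else if (i : ℕ) = (j : ℕ) then (j' : ℕ) else if (i : ℕ) = (j' : ℕ) then (j : ℕ) else (i : ℕ) := by
  have hjv := j.isLt; have hj'v := j'.isLt; have hi := i.isLt
  have hne : (j : ℕ) ≠ (j' : ℕ) := fun h => hjj' (Fin.ext h)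
  have hA : Fin.rev j' ≠ j := by rw [ne_eq, Fin.ext_iff, Fin.val_rev]; omega
  have hB : Fin.rev j' ≠ j' := by rw [ne_eq, Fin.ext_iff, Fin.val_rev]; omega
  have hC : Fin.rev j ≠ j := by rw [ne_eq, Fin.ext_iff, Fin.val_rev]; omega
  have hD : Fin.rev j ≠ j' := by rw [ne_eq, Fin.ext_iff, Fin.val_rev]; omega
  rw [swapPairs, Equiv.Perm.mul_apply]
  rcases eq_or_ne i (Fin.rev j) with h1 | h1
  · rw [h1, Equiv.swap_apply_left, Equiv.swap_apply_of_ne_of_ne hA hB, Fin.val_rev, Fin.val_rev, if_pos (by omega)]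
    omega
  rcases eq_or_ne i (Fin.rev j') with h2 | h2
  · rw [h2, Equiv.swap_apply_right, Equiv.swap_apply_of_ne_of_ne hC hD, Fin.val_rev, Fin.val_rev]
    have h1' : ¬ (N - ((j' : ℕ) + 1) = N - 1 - (j : ℕ)) := by omega
    rw [if_neg h1', if_pos (by omega)]
    omega
  rw [Equiv.swap_apply_of_ne_of_ne h1 h2, Equiv.swap_apply_def]
  have h1' : ¬ ((i : ℕ) = N - 1 - (j : ℕ)) := fun h => h1 (Fin.ext (by rw [Fin.val_rev]; omega))
  have h2' : ¬ ((i : ℕ) = N - 1 - (j' : ℕ)) := fun h => h2 (Fin.ext (by rw [Fin.val_rev]; omega))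
  rw [if_neg h1', if_neg h2']
  by_cases h3 : i = j
  · rw [if_pos h3, if_pos (congrArg Fin.val h3)]
  · rw [if_neg h3, if_neg (fun h => h3 (Fin.ext h))]
    by_cases h4 : i = j'
    · rw [if_pos h4, if_pos (congrArg Fin.val h4)]
    · rw [if_neg h4, if_neg (fun h => h4 (Fin.ext h))]

/-- `(j j')(rev j, rev j')` commutes with `rev`. [cite: BruhatTits1972, (4.4.3)] -/
theorem swapPairs_rev {j j' : Fin N} (hjj' : j ≠ j') (hj : (j : ℕ) < N / 2) (hj' : (j' : ℕ) < N / 2) (i : Fin N) :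
    swapPairs j j' (Fin.rev i) = Fin.rev (swapPairs j j' i) := by
  apply Fin.ext
  rw [swapPairs_val hjj' hj hj', Fin.val_rev, Fin.val_rev, swapPairs_val hjj' hj hj']
  have hjv := j.isLt; have hj'v := j'.isLt; have hi := i.isLt
  have hne : (j : ℕ) ≠ (j' : ℕ) := fun h => hjj' (Fin.ext h)
  split_ifs <;> omega

/-- `(j j')(rev j, rev j')` fixes the indices below `min j j'`. [cite: BruhatTits1972, (4.4.3)] -/
theorem swapPairs_apply_of_lt {j j' : Fin N} (hjj' : j ≠ j') (hj : (j : ℕ) < N / 2) (hj' : (j' : ℕ) < N / 2) {i : Fin N}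
    (hi : (i : ℕ) < (j : ℕ)) (hi' : (i : ℕ) < (j' : ℕ)) : swapPairs j j' i = i := by
  apply Fin.ext
  rw [swapPairs_val hjj' hj hj']
  have hjv := j.isLt; have hj'v := j'.isLt
  split_ifs <;> omega

/-- `(j j')(rev j, rev j') j = j'`. [cite: BruhatTits1972, (4.4.3)] -/
theorem swapPairs_apply_left {j j' : Fin N} (hjj' : j ≠ j') (hj : (j : ℕ) < N / 2) (hj' : (j' : ℕ) < N / 2) :
    swapPairs j j' j = j' := by
  apply Fin.ext
  rw [swapPairs_val hjj' hj hj']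
  have hjv := j.isLt; have hj'v := j'.isLt
  have hne : (j : ℕ) ≠ (j' : ℕ) := fun h => hjj' (Fin.ext h)
  split_ifs <;> omega

/-- **`(k, rev k)`**, the flip of the coordinate pair of `k`. [cite: BruhatTits1972, (4.4.3)] -/
def flipPair (k : Fin N) : Equiv.Perm (Fin N) := Equiv.swap k (Fin.rev k)

/-- The flip commutes with `rev`. [cite: BruhatTits1972, (4.4.3)] -/
theorem flipPair_rev (k i : Fin N) : flipPair k (Fin.rev i) = Fin.rev (flipPair k i) := by
  rw [flipPair]
  rcases eq_or_ne i k with h1 | h1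
  · rw [h1, Equiv.swap_apply_right, Equiv.swap_apply_left, Fin.rev_rev]
  rcases eq_or_ne i (Fin.rev k) with h2 | h2
  · rw [h2, Fin.rev_rev, Equiv.swap_apply_left, Equiv.swap_apply_right]
  rw [Equiv.swap_apply_of_ne_of_ne h1 h2, Equiv.swap_apply_of_ne_of_ne (fun h => h2 (by rw [← h, Fin.rev_rev]))
    (fun h => h1 (Fin.rev_injective h))]

/-- The flip of the pair of `k` fixes `i ∉ {k, rev k}`. [cite: BruhatTits1972, (4.4.3)] -/
theorem flipPair_apply_of_ne {k i : Fin N} (h1 : i ≠ k) (h2 : i ≠ Fin.rev k) : flipPair k i = i :=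
  Equiv.swap_apply_of_ne_of_ne h1 h2

/-- `flipPair k k = rev k`. [cite: BruhatTits1972, (4.4.3)] -/
theorem flipPair_apply_self (k : Fin N) : flipPair k k = Fin.rev k := Equiv.swap_apply_left _ _

/-- **A head-sum lexicographically maximal element of a `W`-stable finite set of antisymmetric exponents is dominant.**  If
`a ∈ S`, `S` is stable under all `rev`-commuting coordinate permutations, every element of `S` is antisymmetric and
`headSumVec b ≤_lex headSumVec a` for all `b ∈ S`, then `a_0 ≥ a_1 ≥ ⋯ ≥ a_{N-1}`. [cite: CartierCorvallis1979, §IV, proof of Thm. 4.1]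
[cite: BruhatTits1972, (4.4.3), (4.4.4)] -/
theorem antitone_of_isMaxOn_headSumVec {S : Finset (Fin N → ℤ)}
    (hS : ∀ μ ∈ S, ∀ π : Equiv.Perm (Fin N), (∀ i, π (Fin.rev i) = Fin.rev (π i)) → μ ∘ π ∈ S)
    (hanti : ∀ μ ∈ S, ∀ i, μ (Fin.rev i) = -μ i) {a : Fin N → ℤ} (ha : a ∈ S)
    (hmax : ∀ b ∈ S, toLex (headSumVec b) ≤ toLex (headSumVec a)) : Antitone a := by
  -- (i) `a` is antitone on the first block
  have step1 : ∀ j j' : Fin N, (j : ℕ) < (j' : ℕ) → (j' : ℕ) < N / 2 → a j' ≤ a j := by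
    intro j j' hlt hj'
    have hj : (j : ℕ) < N / 2 := lt_trans hlt hj'
    have hjj' : j ≠ j' := fun h => by rw [h] at hlt; exact lt_irrefl _ hlt
    by_contra hcon
    rw [not_le] at hcon
    have hb := hS a ha (swapPairs j j') (swapPairs_rev hjj' hj hj')
    refine absurd (hmax _ hb) (not_le.2 (toLex_headSumVec_lt j (fun r hr => ?_) ?_))
    · exact (headSum_comp_eq_of_forall_lt a _ r fun i hi => swapPairs_apply_of_lt hjj' hj hj' (by omega) (by omega)).symm
    · rw [headSum_succ, headSum_succ, headSum_comp_eq_of_forall_lt a _ _ fun i hi => swapPairs_apply_of_lt hjj' hj hj' hi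
        (by omega), Function.comp_apply, swapPairs_apply_left hjj' hj hj']
      omega
  -- (ii) the last coordinate of the first block is `≥ 0`
  have step2 : ∀ j : Fin N, (j : ℕ) + 1 = N / 2 → 0 ≤ a j := by
    intro j hj
    by_contra hcon
    rw [not_le] at hcon
    have hb := hS a ha (flipPair j) (flipPair_rev j)
    have hjv := j.isLt
    refine absurd (hmax _ hb) (not_le.2 (toLex_headSumVec_lt j (fun r hr => ?_) ?_))
    · refine (headSum_comp_eq_of_forall_lt a _ r fun i hi => flipPair_apply_of_ne (fun h => ?_) (fun h => ?_)).symm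
      · rw [h] at hi; omega
      · rw [h, Fin.val_rev] at hi; omega
    · rw [headSum_succ, headSum_succ, headSum_comp_eq_of_forall_lt a _ _ fun i hi => flipPair_apply_of_ne
        (fun h => by rw [h] at hi; omega) (fun h => by rw [h, Fin.val_rev] at hi; omega), Function.comp_apply,
        flipPair_apply_self, hanti a ha]
      omega
  -- (iii) signs: `a ≥ 0` on the first block, `a ≤ 0` beyond it
  have hanti_a := hanti a ha
  have hnonneg : ∀ i : Fin N, (i : ℕ) < N / 2 → 0 ≤ a i := by
    intro i hi
    have hl : 0 ≤ a ⟨N / 2 - 1, by omega⟩ := step2 _ (by simp only; omega)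
    rcases eq_or_lt_of_le (Nat.le_sub_one_of_lt hi) with h | h
    · rw [show i = ⟨N / 2 - 1, by omega⟩ from Fin.ext h]; exact hl
    · exact hl.trans (step1 i ⟨N / 2 - 1, by omega⟩ h (by simp only; omega))
  have hnonpos : ∀ i : Fin N, N / 2 ≤ (i : ℕ) → a i ≤ 0 := by
    intro i hi
    by_cases hmid : N ≤ (i : ℕ) + N / 2
    · -- `rev i` lies in the first block
      have h := hnonneg (Fin.rev i) (by rw [Fin.val_rev]; have := i.isLt; omega)
      rw [hanti_a] at h
      omega
    · -- `i` is the middle index: `rev i = i`, so `a i = 0`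
      have hrev : Fin.rev i = i := Fin.ext (by rw [Fin.val_rev]; omega)
      have h := hanti_a i
      rw [hrev] at h
      omega
  -- (iv) conclusion
  intro i i' hii'
  rcases eq_or_lt_of_le hii' with h | h
  · rw [h]
  by_cases hi' : (i' : ℕ) < N / 2
  · exact step1 i i' h hi'
  rw [not_lt] at hi'
  by_cases hi : (i : ℕ) < N / 2
  · exact (hnonpos i' hi').trans (hnonneg i hi)
  rw [not_lt] at hi
  -- both beyond the first block: compare `rev i' < rev i` in the first block (or `i` is the middle index)
  by_cases hmid : N ≤ (i : ℕ) + N / 2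
  · have h1 : ((Fin.rev i' : Fin N) : ℕ) < ((Fin.rev i : Fin N) : ℕ) := by rw [Fin.val_rev, Fin.val_rev]; omega
    have h2 : ((Fin.rev i : Fin N) : ℕ) < N / 2 := by rw [Fin.val_rev]; have := i.isLt; omega
    have h3 := step1 _ _ h1 h2
    rw [hanti_a, hanti_a] at h3
    omega
  · have hrev : Fin.rev i = i := Fin.ext (by rw [Fin.val_rev]; omega)
    have h0 := hanti_a i
    rw [hrev] at h0
    have : a i = 0 := by omega
    rw [this]
    exact hnonpos i' hi'

end LexMax

/-! ## §3 Finiteness of the dominant antisymmetric exponents below a given one -/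

section Finite

/-- **Finitely many dominant antisymmetric `λ` lie below `a` in the dominance order** (`|λ_i| ≤ λ_0 ≤ a_0`).
[cite: CartierCorvallis1979, §IV, proof of Thm. 4.1] -/
theorem finite_setOf_antitone_headSum_le (a : Fin N → ℤ) :
    Set.Finite {la : Fin N → ℤ | Antitone la ∧ (∀ i, la (Fin.rev i) = -la i) ∧ ∀ r, headSum la r ≤ headSum a r} := by
  rcases Nat.eq_zero_or_pos N with hN | hN
  · subst hN
    exact Set.Finite.subset (Set.finite_singleton (fun _ => 0)) fun la _ => funext fun i => i.elim0
  · set B := a ⟨0, hN⟩ with hB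
    refine Set.Finite.subset (Set.Finite.pi fun _ : Fin N => Set.finite_Icc (-B) B) ?_
    rintro la ⟨hmono, hanti, hle⟩
    simp only [Set.mem_pi, Set.mem_univ, Set.mem_Icc, forall_true_left]
    have h0 : la ⟨0, hN⟩ ≤ B := by
      have h := hle 1
      rw [headSum_succ la ⟨0, hN⟩, headSum_succ a ⟨0, hN⟩, show ((⟨0, hN⟩ : Fin N) : ℕ) = 0 from rfl, headSum_zero,
        headSum_zero, zero_add, zero_add] at h
      exact h
    have hlast : la (Fin.rev ⟨0, hN⟩) = -la ⟨0, hN⟩ := hanti _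
    intro i
    constructor
    · have h1 : la (Fin.rev ⟨0, hN⟩) ≤ la i :=
        hmono (Fin.le_iff_val_le_val.2 (by rw [Fin.val_rev]; have := i.isLt; show (i : ℕ) ≤ N - (0 + 1); omega))
      rw [hlast] at h1
      omega
    · exact (hmono (Fin.le_iff_val_le_val.2 (Nat.zero_le _))).trans h0

end Finite

/-! ## §4 Surjectivity onto `ℂ[Λ⁻]^W` and the Satake isomorphism -/

section Surjective

variable {R : Type*} [CommRing R]

/-- `U(f)`: the dominant antisymmetric exponents lying below (in the dominance order) some dominant exponent of `supp f` — the
finite set on whose size Cartier's triangular induction runs. [cite: CartierCorvallis1979, §IV, proof of Thm. 4.1] -/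
def lowerDominantSet (f : AddMonoidAlgebra R (Fin N → ℤ)) : Set (Fin N → ℤ) :=
  {la | Antitone la ∧ (∀ i, la (Fin.rev i) = -la i) ∧
    ∃ b : Fin N → ℤ, f.coeff b ≠ 0 ∧ Antitone b ∧ ∀ r, headSum la r ≤ headSum b r}

/-- `U(f)` is finite. [cite: CartierCorvallis1979, §IV, proof of Thm. 4.1] -/
theorem finite_lowerDominantSet (f : AddMonoidAlgebra R (Fin N → ℤ)) : (lowerDominantSet f).Finite := by
  refine Set.Finite.subset (Set.Finite.biUnion (Finset.finite_toSet f.coeff.support)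
    fun b _ => finite_setOf_antitone_headSum_le b) ?_
  rintro la ⟨h1, h2, b, hb, -, hle⟩
  exact Set.mem_biUnion (Finsupp.mem_support_iff.2 hb) ⟨h1, h2, hle⟩

variable {K : Type*} [Field K] [Valued K ℤᵐ⁰] {σ : K →+* K} {ϖ : K}

namespace UnramifiedLocalConjDatum

/-- **SURJECTIVITY OF THE SATAKE TRANSFORM ONTO `ℂ[Λ⁻]^W`** (Cartier Thm. 4.1, proof (c)): every Weyl-invariant Laurent polynomial
supported on `Λ⁻` is the transform of a Hecke operator — by induction on `#U(f)`, subtracting the right multiple of `𝒮(T_a)`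
for the head-sum-maximal (hence dominant) exponent `a ∈ supp f`. [cite: CartierCorvallis1979, §IV Thm. 4.1 and its proof]
[cite: Satake1963, §6 Thm. 7] [cite: BruhatTits1972, (4.4.4)] -/
theorem exists_satakeTransform_eq (hd : UnramifiedLocalConjDatum σ ϖ) [Finite 𝓀[K]] (hσ : ∃ x : K, σ x ≠ x)
    (f : AddMonoidAlgebra ℂ (Fin N → ℤ)) (hf : f ∈ unitarySatakeTarget ℂ N) :
    ∃ T : heckeAlgebra ℂ (unitaryGroupOfForm σ ((StdForm.antidiagonal N).over K)) (unitaryInt σ ((StdForm.antidiagonal N).over K)),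
      hd.satakeTransform T = f := by
  classical
  haveI := isHeckeTriple_unitaryInt_of_finite_residueField hd.vϖ σ ((StdForm.antidiagonal N).over K)
  suffices H : ∀ (m : ℕ) (f : AddMonoidAlgebra ℂ (Fin N → ℤ)), f ∈ unitarySatakeTarget ℂ N →
      (finite_lowerDominantSet f).toFinset.card = m →
      ∃ T : heckeAlgebra ℂ (unitaryGroupOfForm σ ((StdForm.antidiagonal N).over K)) (unitaryInt σ ((StdForm.antidiagonal N).over K)),
        hd.satakeTransform T = f from H _ f hf rfl
  intro m
  induction m using Nat.strong_induction_on with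
  | _ m ih =>
  intro f hf hm
  by_cases h0 : f = 0
  · exact ⟨0, by rw [h0, map_zero]⟩
  obtain ⟨hsupp, hW⟩ := (mem_unitarySatakeTarget_iff f).1 hf
  -- the head-sum-maximal exponent `a ∈ supp f` is dominant
  have hSne : f.coeff.support.Nonempty := by
    rw [Finsupp.support_nonempty_iff, ne_eq, AddMonoidAlgebra.coeff_eq_zero]
    exact h0
  obtain ⟨a, haS, hmax⟩ := f.coeff.support.exists_max_image (fun μ => toLex (headSumVec μ)) hSne
  have haS' : f.coeff a ≠ 0 := Finsupp.mem_support_iff.1 haS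
  have hanti : ∀ μ ∈ f.coeff.support, ∀ i, μ (Fin.rev i) = -μ i := fun μ hμ => by
    by_contra h
    exact Finsupp.mem_support_iff.1 hμ (hsupp μ h)
  have hstab : ∀ μ ∈ f.coeff.support, ∀ π : Equiv.Perm (Fin N), (∀ i, π (Fin.rev i) = Fin.rev (π i)) → μ ∘ π ∈ f.coeff.support :=
    fun μ hμ π hπ => by
      rw [Finsupp.mem_support_iff] at hμ ⊢
      rwa [hW π hπ μ]
  have hmono : Antitone a := antitone_of_isMaxOn_headSumVec hstab hanti haS hmax
  have ha : Antitone a ∧ ∀ i, a (Fin.rev i) = -a i := ⟨hmono, hanti a haS⟩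
  -- the basic operator `T_a` and its transform `F = c x^a + lower terms`
  set Ta : heckeAlgebra ℂ (unitaryGroupOfForm σ ((StdForm.antidiagonal N).over K)) (unitaryInt σ ((StdForm.antidiagonal N).over K)) :=
    heckeAlgebra.doubleCosetOperator (unitaryInt σ ((StdForm.antidiagonal N).over K))
      (⟨zpowDiagGL (uniformizer_ne_zero hd.vϖ) a, zpowDiagGL_mem_unitaryGroupOfForm hd.σϖ _ ha.2⟩ :
        unitaryGroupOfForm σ ((StdForm.antidiagonal N).over K)) with hTa
  set F := hd.satakeTransform Ta with hFdef
  have hc : F.coeff a ≠ 0 := hd.coeff_self_satakeTransform_doubleCosetOperator_ne_zero ha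
  have htri : ∀ μ, F.coeff μ ≠ 0 → ∀ r, headSum μ r ≤ headSum a r := fun μ hμ r =>
    hd.sum_le_of_coeff_satakeTransform_doubleCosetOperator_ne_zero ha hμ r
  have hF : F ∈ unitarySatakeTarget ℂ N := hd.satakeTransform_mem_unitarySatakeTarget hσ Ta
  -- `g = f - (f_a / c) F`
  set k : ℂ := f.coeff a * (F.coeff a)⁻¹ with hk
  set g := f - k • F with hgdef
  have hg : g ∈ unitarySatakeTarget ℂ N := Subalgebra.sub_mem _ hf (Subalgebra.smul_mem _ hF k)
  have hgcoeff : ∀ μ, g.coeff μ = f.coeff μ - k * F.coeff μ := fun μ => by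
    rw [hgdef, AddMonoidAlgebra.coeff_sub, AddMonoidAlgebra.coeff_smul, Finsupp.sub_apply, Finsupp.smul_apply, smul_eq_mul]
  have hga : g.coeff a = 0 := by rw [hgcoeff, hk, inv_mul_cancel_right₀ hc, sub_self]
  have hgsupp : ∀ μ, g.coeff μ ≠ 0 → f.coeff μ ≠ 0 ∨ F.coeff μ ≠ 0 := fun μ h => by
    by_contra h'
    rw [not_or, not_ne_iff, not_ne_iff] at h'
    exact h (by rw [hgcoeff, h'.1, h'.2, mul_zero, sub_zero])
  -- `U(g) ⊊ U(f)`
  have hsub : lowerDominantSet g ⊆ lowerDominantSet f := by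
    rintro la ⟨h1, h2, b, hb, hbm, hle⟩
    rcases hgsupp b hb with hbf | hbF
    · exact ⟨h1, h2, b, hbf, hbm, hle⟩
    · exact ⟨h1, h2, a, haS', hmono, fun r => (hle r).trans (htri b hbF r)⟩
  have haU : a ∈ lowerDominantSet f := ⟨hmono, ha.2, a, haS', hmono, fun _ => le_rfl⟩
  have haU' : a ∉ lowerDominantSet g := by
    rintro ⟨-, -, b, hb, -, hle⟩
    have hba : a = b := by
      rcases hgsupp b hb with hbf | hbF
      · exact eq_of_headSum_le_of_toLex_le hle (hmax b (Finsupp.mem_support_iff.2 hbf))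
      · exact eq_of_headSum_le_antisymm hle (htri b hbF)
    rw [← hba] at hb
    exact hb hga
  have hlt : (finite_lowerDominantSet g).toFinset.card < (finite_lowerDominantSet f).toFinset.card :=
    Finset.card_lt_card (Set.Finite.toFinset_ssubset_toFinset.2 ((Set.ssubset_iff_of_subset hsub).2 ⟨a, haU, haU'⟩))
  obtain ⟨T', hT'⟩ := ih _ (hm ▸ hlt) g hg rfl
  refine ⟨T' + k • Ta, ?_⟩
  rw [map_add, map_smul, hT', hgdef, sub_add_cancel]

/-- **`range 𝒮 = ℂ[Λ⁻]^W`.** [cite: CartierCorvallis1979, §IV Thm. 4.1] [cite: Satake1963, §6 Thm. 7] -/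
theorem range_satakeTransform_eq_unitarySatakeTarget (hd : UnramifiedLocalConjDatum σ ϖ) [Finite 𝓀[K]] (hσ : ∃ x : K, σ x ≠ x) :
    (hd.satakeTransform (N := N)).range = unitarySatakeTarget ℂ N :=
  le_antisymm (hd.range_satakeTransform_le_unitarySatakeTarget hσ) fun f hf =>
    (AlgHom.mem_range _).2 (hd.exists_satakeTransform_eq hσ f hf)

/-- **THE SATAKE ISOMORPHISM FOR THE QUASI-SPLIT UNITARY GROUP `U(σ, J₀^{(N)})` IN EVERY RANK**:
`𝒮 : ℋ(U(σ, J₀^{(N)}), K₀) ⥲ ℂ[Λ⁻]^W`, an isomorphism of `ℂ`-algebras onto the Weyl invariants of the group algebra of the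
antisymmetric cocharacters (`σ ≠ id`, finite residue field; `K₀` hyperspecial). [cite: CartierCorvallis1979, §IV Thm. 4.1]
[cite: Satake1963, §6 Thm. 7] [cite: Minguez2011, §4] -/
def satakeAlgEquiv (hd : UnramifiedLocalConjDatum σ ϖ) [Finite 𝓀[K]] (hσ : ∃ x : K, σ x ≠ x) :
    heckeAlgebra ℂ (unitaryGroupOfForm σ ((StdForm.antidiagonal N).over K)) (unitaryInt σ ((StdForm.antidiagonal N).over K)) ≃ₐ[ℂ]
      unitarySatakeTarget ℂ N :=
  AlgEquiv.ofBijective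
    ((hd.satakeTransform (N := N)).codRestrict (unitarySatakeTarget ℂ N) fun T => hd.satakeTransform_mem_unitarySatakeTarget hσ T)
    ⟨fun T T' h => hd.satakeTransform_injective (congrArg Subtype.val h),
      fun f => by
        obtain ⟨T, hT⟩ := hd.exists_satakeTransform_eq hσ f.1 f.2
        exact ⟨T, Subtype.ext hT⟩⟩

/-- The Satake isomorphism is the Satake transform. [cite: CartierCorvallis1979, §IV Thm. 4.1] -/
@[simp] theorem coe_satakeAlgEquiv (hd : UnramifiedLocalConjDatum σ ϖ) [Finite 𝓀[K]] (hσ : ∃ x : K, σ x ≠ x)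
    (T : heckeAlgebra ℂ (unitaryGroupOfForm σ ((StdForm.antidiagonal N).over K)) (unitaryInt σ ((StdForm.antidiagonal N).over K))) :
    ((hd.satakeAlgEquiv hσ T : unitarySatakeTarget ℂ N) : AddMonoidAlgebra ℂ (Fin N → ℤ)) = hd.satakeTransform T := rfl

end UnramifiedLocalConjDatum

end Surjective

end Literature.NumberTheory.Automorphic.HermitianLattice

end
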